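import Literature.Analysis.FunctionSpaces.TorusMollifierEstimates
import Literature.Analysis.FunctionSpaces.TorusMollifiedFields
import Literature.Analysis.FunctionSpaces.TorusTestFunction
import Literature.Analysis.FunctionSpaces.TimeMollification
import HarnessLib

/-!
# Time averages of space–time fields on `T^d`

Analysis/FunctionSpaces support file (serves the discharge of Onsager rigidity,
`Literature.Analysis.FluidPDE.onsager_rigidity`, `FluidPDE/Onsager`: the "straightforward extra arguments needed to
mollify in time" of Constantin–E–Titi 1994, p. 208). For a space–time field
`G : ℝ → X → F` (time first) and a time kernel `r : ℝ → ℝ` we consider the time average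
`timeAvgWith r G t x = (r ⋆ G(·, x))(t) = ∫ r(s) G(t - s, x) ds` (Mathlib's convolution on `ℝ`
in each fibre; for `r = ρ` a normalised bump this is the time mollification `timeAvg` of the
tree's `TimeMollification`). We prove, for `X = T^d` the flat torus:

* `timeAvgWith_apply`, `timeAvgWith_eq_integral_sub`, the component and support lemmas;
* measurability and the fibrewise Young inequality (re-exported from `TimeMollification`);
* `Torus.integrable_timeAvgWith`: slices of the time average of an integrable space–time field
  are integrable on `T^d`;
* `Torus.timeAvgWith_convolution` — **time averaging commutes with spatial mollification**:
  `(timeAvgWith r G t) ⋆ κ = timeAvgWith r (s ↦ G s ⋆ κ) t` (Fubini);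
* `Torus.hasDerivAt_timeAvgWith` — `∂ₜ (ρ ⋆ₜ G) = ρ' ⋆ₜ G` (Mathlib's
  `HasCompactSupport.hasDerivAt_convolution_left`);
* `Torus.isWeaklyDivFree_timeAvgWith` — time averages of a.e.-in-time weakly divergence-free
  fields are weakly divergence free at every time (Fubini).

## Mathlib search

Mathlib (this pin) has convolution on `ℝ` with smooth compactly supported kernels and its
derivative (`HasCompactSupport.hasDerivAt_convolution_left`), Fubini
(`MeasureTheory.integral_integral_swap`); the tree has the fibrewise time mollification
(`Literature.Analysis.FunctionSpaces.stronglyMeasurable_timeConv`, `Literature.Analysis.FunctionSpaces.eLpNorm_timeConv_le`, `Literature.Analysis.FunctionSpaces.tendsto_eLpNorm_timeConv_sub`,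
`TimeMollification`). The commutation with spatial mollification on the torus and the
preservation of weak incompressibility are not in either (searched `timeConv`, `convolution` +
`IsWeaklyDivFree`).

## References

* P. Constantin, W. E, E. S. Titi, *Onsager's conjecture on the energy conservation for solutions
  of Euler's equation*, Comm. Math. Phys. 165 (1994), 207–209, p. 208.
* J. Serrin, *The initial value problem for the Navier–Stokes equations*, in: Nonlinear Problems
  (Madison 1962), Univ. Wisconsin Press 1963, §4 (mollification in time of weak solutions).
-/

noncomputable section

open MeasureTheory TopologicalSpace Set Function Filter Topology Metric ContinuousLinearMap
open scoped ENNReal NNReal Convolution InnerProductSpace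

namespace Literature.Analysis.FunctionSpaces

/-! ## Time averages in each fibre -/

section TimeAvg

variable {X : Type*} {F : Type*} [NormedAddCommGroup F] [NormedSpace ℝ F]

/-- **Time support.** If `G s = 0` for `s ∉ [a, b]` and `r` vanishes off `(-δ, δ)`, then
`timeAvgWith r G t = 0` whenever `t + δ ≤ a` or `b ≤ t - δ`. [folklore] -/
theorem timeAvgWith_eq_zero_of_forall {r : ℝ → ℝ} {δ : ℝ} (hr : ∀ s, δ ≤ |s| → r s = 0)
    {G : ℝ → X → F} {a b : ℝ} (hG : ∀ s, s ∉ Icc a b → G s = 0) {t : ℝ}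
    (ht : t + δ ≤ a ∨ b ≤ t - δ) : timeAvgWith r G t = 0 := by
  funext x
  rw [timeAvgWith_apply, Pi.zero_apply]
  refine integral_eq_zero_of_ae (Eventually.of_forall fun s => ?_)
  by_cases hs : δ ≤ |s|
  · simp [hr s hs]
  · have hs' : |s| < δ := not_le.1 hs
    have hts : t - s ∉ Icc a b := by
      intro h
      rcases ht with ht | ht
      · linarith [h.1, (abs_lt.1 hs').1, (abs_lt.1 hs').2]
      · linarith [h.2, (abs_lt.1 hs').1, (abs_lt.1 hs').2]
    simp [hG _ hts]

/-- Oddness of the derivative of an even kernel: `ρ'(-s) = -ρ'(s)`. [folklore] -/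
theorem deriv_neg_of_even {ρ : ℝ → ℝ} (hρ : ∀ s, ρ (-s) = ρ s) (s : ℝ) :
    deriv ρ (-s) = -deriv ρ s := by
  have h : (fun x => ρ (-x)) = ρ := funext hρ
  have h2 := deriv_comp_neg ρ s
  rw [h] at h2
  linarith

/-- The derivative of the (even) normalised bump kernel is odd. [folklore] -/
theorem deriv_normed_neg (φ : ContDiffBump (0 : ℝ)) (s : ℝ) :
    deriv (φ.normed volume) (-s) = -deriv (φ.normed volume) s :=
  deriv_neg_of_even (fun x => φ.normed_neg x) s

/-- Components of a vector-valued time average (finite-dimensional range): for an integrable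
fibre integrand, `(timeAvgWith r G t x) i = timeAvgWith r (Gᵢ) t x`. [folklore] -/
theorem timeAvgWith_apply_euclidean {ι : Type*} [Fintype ι] {r : ℝ → ℝ}
    {G : ℝ → X → EuclideanSpace ℝ ι} {t : ℝ} {x : X}
    (h : Integrable (fun s => r s • G (t - s) x) volume) (i : ι) :
    timeAvgWith r G t x i = timeAvgWith r (fun s y => G s y i) t x := by
  rw [timeAvgWith_apply, timeAvgWith_apply]
  have h2 := (EuclideanSpace.proj i : EuclideanSpace ℝ ι →L[ℝ] ℝ).integral_comp_comm h
  simp only [map_smul] at h2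
  exact h2.symm

end TimeAvg

/-! ## Measurability and the fibrewise Young inequality (re-exported) -/

section Measurable

variable {X : Type*} [MeasurableSpace X] {μ : Measure X} [SFinite μ]
variable {F : Type*} [NormedAddCommGroup F] [NormedSpace ℝ F]

/-- The time average of a jointly measurable field by a bump kernel is jointly measurable
(tree `Literature.Analysis.FunctionSpaces.stronglyMeasurable_timeConv`). [folklore] -/
theorem stronglyMeasurable_uncurry_timeAvgWith (φ : ContDiffBump (0 : ℝ)) {G : ℝ → X → F}
    (hG : StronglyMeasurable (uncurry G)) :
    StronglyMeasurable (uncurry (timeAvgWith (φ.normed volume) G)) :=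
  stronglyMeasurable_timeConv φ hG

/-- Joint measurability of a time average by a general continuous kernel `r`. [folklore] -/
theorem stronglyMeasurable_uncurry_timeAvgWith' {r : ℝ → ℝ} (hr : Continuous r) {G : ℝ → X → F}
    (hG : StronglyMeasurable (uncurry G)) :
    StronglyMeasurable (uncurry (timeAvgWith r G)) := by
  have h1 : StronglyMeasurable fun q : (ℝ × X) × ℝ => r q.2 • G (q.1.1 - q.2) q.1.2 := by
    have hc : StronglyMeasurable fun q : (ℝ × X) × ℝ => r q.2 :=
      (hr.measurable.comp measurable_snd).stronglyMeasurable
    have hm : StronglyMeasurable fun q : (ℝ × X) × ℝ => G (q.1.1 - q.2) q.1.2 :=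
      hG.comp_measurable ((measurable_fst.fst.sub measurable_snd).prodMk measurable_fst.snd)
    exact hc.smul hm
  have h2 := h1.integral_prod_right' (ν := (volume : Measure ℝ))
  have heq : uncurry (timeAvgWith r G) = fun z => ∫ τ, r τ • G (z.1 - τ) z.2 := by
    funext z
    simp only [uncurry, timeAvgWith_apply]
  rw [heq]
  exact h2

/-- Time averaging by a bump kernel does not increase `L^p(ℝ × X)` norms, `1 ≤ p < ∞`
(tree `Literature.Analysis.FunctionSpaces.eLpNorm_timeConv_le`). [folklore] -/
theorem eLpNorm_uncurry_timeAvgWith_le (φ : ContDiffBump (0 : ℝ)) {G : ℝ → X → F}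
    (hG : StronglyMeasurable (uncurry G)) {p : ℝ≥0∞} (hp : 1 ≤ p) (hp' : p ≠ ⊤) :
    eLpNorm (uncurry (timeAvgWith (φ.normed volume) G)) p ((volume : Measure ℝ).prod μ) ≤
      eLpNorm (uncurry G) p ((volume : Measure ℝ).prod μ) :=
  eLpNorm_timeConv_le φ hG hp hp'

end Measurable

/-! ## Time averages of space–time fields on the torus -/

namespace Torus

variable {d : Type*} [Fintype d]
variable {F : Type*} [NormedAddCommGroup F] [NormedSpace ℝ F]

/-- A continuous compactly supported real function is bounded. [folklore] -/
theorem exists_forall_abs_le_of_hasCompactSupport' {r : ℝ → ℝ} (hr : Continuous r)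
    (hrc : HasCompactSupport r) : ∃ C, 0 ≤ C ∧ ∀ s, ‖r s‖ ≤ C := by
  obtain ⟨C, hC⟩ := hr.bounded_above_of_compact_support hrc
  exact ⟨C, (norm_nonneg _).trans (hC 0), hC⟩

/-- The time shear `(s, y) ↦ (t - s, y)` preserves `vol ⊗ vol` on `ℝ × T^d`. [folklore] -/
theorem measurePreserving_timeShear (t : ℝ) :
    MeasurePreserving (fun p : ℝ × UnitAddTorus d => (t - p.1, p.2))
      ((volume : Measure ℝ).prod volume) ((volume : Measure ℝ).prod volume) :=
  (Measure.measurePreserving_sub_left volume t).prod (MeasurePreserving.id volume)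

/-- **The shifted integrand of a time average is integrable on `ℝ × T^d`**: for
`G ∈ L¹(ℝ × T^d)` and a continuous compactly supported time kernel `r`,
`(s, y) ↦ r(s) • G(t - s, y)` is integrable. [folklore] -/
theorem integrable_kernel_smul_timeShift {G : ℝ → UnitAddTorus d → F}
    (hG : Integrable (uncurry G) ((volume : Measure ℝ).prod volume)) {r : ℝ → ℝ}
    (hr : Continuous r) (hrc : HasCompactSupport r) (t : ℝ) :
    Integrable (fun p : ℝ × UnitAddTorus d => r p.1 • G (t - p.1) p.2)
      ((volume : Measure ℝ).prod volume) := by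
  obtain ⟨C, -, hC⟩ := exists_forall_abs_le_of_hasCompactSupport' hr hrc
  have h1 : Integrable (fun p : ℝ × UnitAddTorus d => G (t - p.1) p.2)
      ((volume : Measure ℝ).prod volume) :=
    (measurePreserving_timeShear t).integrable_comp hG.aestronglyMeasurable |>.2 hG
  exact h1.bdd_smul C (hr.comp_aestronglyMeasurable measurable_fst.aestronglyMeasurable)
    (Eventually.of_forall fun p => hC p.1)

/-- **Slices of time averages are integrable on the torus**: for `G ∈ L¹(ℝ × T^d)` and a
continuous compactly supported kernel, `timeAvgWith r G t ∈ L¹(T^d)` for every `t`. [folklore] -/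
theorem integrable_timeAvgWith {G : ℝ → UnitAddTorus d → F}
    (hG : Integrable (uncurry G) ((volume : Measure ℝ).prod volume)) {r : ℝ → ℝ}
    (hr : Continuous r) (hrc : HasCompactSupport r) (t : ℝ) :
    Integrable (timeAvgWith r G t) volume := by
  have h := (integrable_kernel_smul_timeShift hG hr hrc t).swap.integral_prod_left
  refine (integrable_congr (Eventually.of_forall fun y => ?_)).1 h
  simp only [comp_apply, Prod.swap_prod_mk, timeAvgWith_apply]

/-- **Time averaging commutes with spatial mollification** (scalar fields): for
`G ∈ L¹(ℝ × T^d)`, a continuous compactly supported time kernel `r` and a continuous space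
kernel `κ`, `(timeAvgWith r G t) ⋆ κ = timeAvgWith r (s ↦ G s ⋆ κ) t` (Fubini on `ℝ × T^d`).
[folklore] -/
theorem timeAvgWith_convolution [CompleteSpace F] {G : ℝ → UnitAddTorus d → ℝ}
    (hG : Integrable (uncurry G) ((volume : Measure ℝ).prod volume)) {r : ℝ → ℝ}
    (hr : Continuous r) (hrc : HasCompactSupport r) {κ : UnitAddTorus d → F} (hκ : Continuous κ)
    (t : ℝ) :
    (timeAvgWith r G t) ⋆ κ = timeAvgWith r (fun s => G s ⋆ κ) t := by
  funext x
  obtain ⟨Cκ, hCκ⟩ := exists_forall_norm_le_of_continuous hκ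
  -- the integrable kernel on `ℝ × T^d`
  have hφ : Integrable (fun p : ℝ × UnitAddTorus d => r p.1 * G (t - p.1) p.2)
      ((volume : Measure ℝ).prod volume) := integrable_kernel_smul_timeShift hG hr hrc t
  have hH : Integrable (fun p : ℝ × UnitAddTorus d => (r p.1 * G (t - p.1) p.2) • κ (x - p.2))
      ((volume : Measure ℝ).prod volume) :=
    hφ.smul_bdd Cκ ((hκ.comp (continuous_const.sub continuous_snd)).aestronglyMeasurable)
      (Eventually.of_forall fun p => hCκ _)
  -- left-hand side as an iterated integral `∫_y ∫_s`
  have hL : ((timeAvgWith r G t) ⋆ κ) x = ∫ y, ∫ s, (r s * G (t - s) y) • κ (x - y) := by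
    rw [convolution_lsmul]
    refine integral_congr_ae (Eventually.of_forall fun y => ?_)
    dsimp only
    rw [timeAvgWith_apply, ← integral_smul_const]
    rfl
  -- right-hand side as an iterated integral `∫_s ∫_y`
  have hR : timeAvgWith r (fun s => G s ⋆ κ) t x = ∫ s, ∫ y, (r s * G (t - s) y) • κ (x - y) := by
    rw [timeAvgWith_apply]
    refine integral_congr_ae (Eventually.of_forall fun s => ?_)
    dsimp only
    rw [convolution_lsmul, ← integral_smul]
    refine integral_congr_ae (Eventually.of_forall fun y => ?_)
    dsimp only
    rw [smul_smul]
  rw [hL, hR]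
  exact (integral_integral_swap hH).symm

omit [Fintype d] in
/-- **The time derivative of a time average**: for a `C¹` compactly supported kernel `ρ` and a
fibre `s ↦ G s y` that is locally integrable, `∂ₜ timeAvgWith ρ G t y = timeAvgWith ρ' G t y`
(Mathlib's `HasCompactSupport.hasDerivAt_convolution_left`). [folklore] -/
theorem hasDerivAt_timeAvgWith {ρ : ℝ → ℝ} (hρ : ContDiff ℝ 1 ρ) (hρc : HasCompactSupport ρ)
    {G : ℝ → UnitAddTorus d → F} {y : UnitAddTorus d}
    (hG : LocallyIntegrable (fun s => G s y) volume) (t : ℝ) :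
    HasDerivAt (fun τ => timeAvgWith ρ G τ y) (timeAvgWith (deriv ρ) G t y) t :=
  hρc.hasDerivAt_convolution_left (lsmul ℝ ℝ) hρ hG t

/-- **Time averages of a.e. weakly divergence-free fields are weakly divergence free**: if
`G ∈ L¹(ℝ × T^d; ℝ^d)` and `G s` is weakly divergence free for a.e. `s`, then
`timeAvgWith r G t` is weakly divergence free for every `t` (Fubini against `∇θ`). [folklore] -/
theorem isWeaklyDivFree_timeAvgWith {G : ℝ → UnitAddTorus d → EuclideanSpace ℝ d}
    (hG : Integrable (uncurry G) ((volume : Measure ℝ).prod volume))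
    (hdiv : ∀ᵐ s, IsWeaklyDivFree (G s)) {r : ℝ → ℝ} (hr : Continuous r)
    (hrc : HasCompactSupport r) (t : ℝ) :
    IsWeaklyDivFree (timeAvgWith r G t) := by
  intro θ hθ
  obtain ⟨Cθ, hCθ⟩ := exists_forall_norm_le_of_continuous hθ.gradient.continuous
  have hφ := integrable_kernel_smul_timeShift hG hr hrc t
  -- the pairing integrand on `ℝ × T^d`
  have hH : Integrable (fun p : ℝ × UnitAddTorus d =>
      ⟪r p.1 • G (t - p.1) p.2, Torus.gradient θ p.2⟫_ℝ) ((volume : Measure ℝ).prod volume) := by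
    refine (hφ.norm.mul_const Cθ).mono' ?_ (Eventually.of_forall fun p => ?_)
    · exact hφ.aestronglyMeasurable.inner
        (hθ.gradient.continuous.comp_aestronglyMeasurable measurable_snd.aestronglyMeasurable)
    · exact (norm_inner_le_norm _ _).trans (mul_le_mul_of_nonneg_left (hCθ _) (norm_nonneg _))
  -- fibrewise: `⟪∫ r G, ∇θ⟫ = ∫ ⟪∇θ, r G⟫`
  have hsec : ∀ᵐ y ∂(volume : Measure (UnitAddTorus d)),
      Integrable (fun s => r s • G (t - s) y) volume := hφ.swap.prod_right_ae
  have h1 : ∫ y, ⟪timeAvgWith r G t y, Torus.gradient θ y⟫_ℝ =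
      ∫ y, ∫ s, ⟪Torus.gradient θ y, r s • G (t - s) y⟫_ℝ := by
    refine integral_congr_ae ?_
    filter_upwards [hsec] with y hy
    rw [timeAvgWith_apply, real_inner_comm, integral_inner hy]
  -- swap and use weak incompressibility at a.e. shifted time
  have hH' : Integrable (uncurry fun (y : UnitAddTorus d) (s : ℝ) =>
      ⟪Torus.gradient θ y, r s • G (t - s) y⟫_ℝ) ((volume : Measure (UnitAddTorus d)).prod volume) := by
    refine (integrable_congr (Eventually.of_forall fun q => ?_)).1 hH.swap
    simp only [uncurry, comp_apply, Prod.fst_swap, Prod.snd_swap, real_inner_comm]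
  have hdiv' : ∀ᵐ s ∂(volume : Measure ℝ), IsWeaklyDivFree (G (t - s)) :=
    (Measure.measurePreserving_sub_left volume t).quasiMeasurePreserving.ae hdiv
  rw [h1, integral_integral_swap hH']
  refine integral_eq_zero_of_ae ?_
  filter_upwards [hdiv'] with s hs
  show _ = (0 : ℝ)
  have h2 : (fun y => ⟪Torus.gradient θ y, r s • G (t - s) y⟫_ℝ) =
      fun y => r s * ⟪G (t - s) y, Torus.gradient θ y⟫_ℝ := by
    funext y
    rw [real_inner_smul_right, real_inner_comm]
  rw [h2, integral_const_mul, hs θ hθ, mul_zero]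

/-! ## Derivatives of space–time mollifications and the vector time average -/

section Vec

variable [DecidableEq d]

/-- **Space derivatives of space–time mollifications**: for `uncurry G ∈ L¹(ℝ × T^d)` (real)
and a smooth space kernel `k`, `∂ⱼ((timeAvgWith r G t) ⋆ k) = timeAvgWith r (s ↦ G s ⋆ ∂ⱼk) t`
(the tree's `Torus.partialDeriv_convolution` and the commutation of time averaging with
spatial mollification by the continuous kernel `∂ⱼk`). [folklore] -/
theorem partialDeriv_convolution_timeAvgWith {G : ℝ → UnitAddTorus d → ℝ}
    (hG : Integrable (uncurry G) ((volume : Measure ℝ).prod volume)) {r : ℝ → ℝ}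
    (hr : Continuous r) (hrc : HasCompactSupport r) {k : UnitAddTorus d → F} [CompleteSpace F]
    (hk : IsSmooth k) (t : ℝ) (j : d) :
    partialDeriv j ((timeAvgWith r G t) ⋆ k) =
      timeAvgWith r (fun s => G s ⋆ partialDeriv j k) t := by
  funext x
  rw [partialDeriv_convolution (integrable_timeAvgWith hG hr hrc t) hk,
    timeAvgWith_convolution hG hr hrc (hk.partialDeriv j).continuous t]

end Vec

omit [Fintype d] in
/-- Weak incompressibility only depends on the a.e. class of the field. [folklore] -/
theorem IsWeaklyDivFree.congr_ae [Fintype d] {u u' : UnitAddTorus d → EuclideanSpace ℝ d}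
    (hu : IsWeaklyDivFree u) (h : u =ᵐ[volume] u') : IsWeaklyDivFree u' := by
  intro θ hθ
  rw [← hu θ hθ]
  refine integral_congr_ae ?_
  filter_upwards [h] with y hy
  rw [hy]

/-- Mollification only depends on the a.e. class of the (left, rough) factor. [folklore] -/
theorem convolution_congr_ae_left {E' : Type*} [NormedAddCommGroup E'] [NormedSpace ℝ E']
    {F' : Type*} [NormedAddCommGroup F'] [NormedSpace ℝ F'] (L : E' →L[ℝ] F' →L[ℝ] F)
    {θ θ' : UnitAddTorus d → E'} (h : θ =ᵐ[volume] θ') (k : UnitAddTorus d → F') :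
    θ ⋆[L, volume] k = θ' ⋆[L, volume] k := by
  funext x
  simp only [convolution_def]
  refine integral_congr_ae ?_
  filter_upwards [h] with y hy
  rw [hy]

/-- The componentwise and the vector-valued time averages agree a.e. on the torus (wherever
the fibre `s ↦ r(s) U(t - s, y)` is integrable, which holds for a.e. `y` by Fubini). [folklore] -/
theorem timeAvgVec_ae_eq {U : ℝ → UnitAddTorus d → EuclideanSpace ℝ d}
    (hU : Integrable (uncurry U) ((volume : Measure ℝ).prod volume)) {r : ℝ → ℝ}
    (hr : Continuous r) (hrc : HasCompactSupport r) (t : ℝ) :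
    timeAvgVec r U t =ᵐ[volume] timeAvgWith r U t := by
  have hsec : ∀ᵐ y ∂(volume : Measure (UnitAddTorus d)),
      Integrable (fun s => r s • U (t - s) y) volume :=
    (integrable_kernel_smul_timeShift hU hr hrc t).swap.prod_right_ae
  filter_upwards [hsec] with y hy
  ext i
  rw [timeAvgVec_apply, timeAvgWith_apply_euclidean hy]

/-- Coordinates of an integrable space–time vector field are integrable. [folklore] -/
theorem integrable_uncurry_apply {U : ℝ → UnitAddTorus d → EuclideanSpace ℝ d}
    (hU : Integrable (uncurry U) ((volume : Measure ℝ).prod volume)) (i : d) :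
    Integrable (uncurry fun s y => U s y i) ((volume : Measure ℝ).prod volume) := by
  have h := (EuclideanSpace.proj i : EuclideanSpace ℝ d →L[ℝ] ℝ).integrable_comp hU
  exact h

/-- **The vector time average of an a.e. weakly divergence-free field is weakly divergence
free** at every time. [folklore] -/
theorem isWeaklyDivFree_timeAvgVec {U : ℝ → UnitAddTorus d → EuclideanSpace ℝ d}
    (hU : Integrable (uncurry U) ((volume : Measure ℝ).prod volume))
    (hdiv : ∀ᵐ s, IsWeaklyDivFree (U s)) {r : ℝ → ℝ} (hr : Continuous r)
    (hrc : HasCompactSupport r) (t : ℝ) : IsWeaklyDivFree (timeAvgVec r U t) :=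
  (isWeaklyDivFree_timeAvgWith hU hdiv hr hrc t).congr_ae (timeAvgVec_ae_eq hU hr hrc t).symm

/-- Slices of the vector time average are integrable. [folklore] -/
theorem integrable_timeAvgVec {U : ℝ → UnitAddTorus d → EuclideanSpace ℝ d}
    (hU : Integrable (uncurry U) ((volume : Measure ℝ).prod volume)) {r : ℝ → ℝ}
    (hr : Continuous r) (hrc : HasCompactSupport r) (t : ℝ) :
    Integrable (timeAvgVec r U t) volume :=
  (integrable_timeAvgWith hU hr hrc t).congr (timeAvgVec_ae_eq hU hr hrc t).symm

end Torus

end Literature.Analysis.FunctionSpaces
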